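import Mathlib
import HarnessLib
import Summits.NavierStokesRegularity.NavierStokesRegularity.Theorems.UnthreadedDoorVorticityOfClass

/-!
# Route `UnthreadedDoor`, crux `PoloidalLiouville` (stmt-NavierStokesRegularity-1222), WALL W1 — crux idea «kinematic-shadow»
# (ns-idea-15 g6, `Cruxes/PoloidalLiouville/KinematicShadowSketch.lean` v1.1 0048538304c1): the BRIDGE Prop `BoundedCurlOfClass`, BY NAME

`KinematicShadow.boundedCurlOfClass : <body of KinematicShadow.BoundedCurlOfClass VERBATIM>`: a bounded ancient mild solution (`ν = 1`,
duality class) with measurable slices and jointly `C^∞` velocity on `(−∞,0) × ℝ³` has BOUNDED VORTICITY.  This is the second conjunct of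
the landed antidynamo bridge `Theorems.PoloidalLiouville.vorticityOfClass` (p629171, `StubVorticityOfClass` of the v2 skeleton;
[KNSS 2009 §4]: bounded mild ancient solutions have bounded derivatives) — a by-name projection, no new mathematics (critic V20: «`BoundedCurlOfClass`
= 2nd conjunct of `StubVorticityOfClass`»).  With it the sketch's kernel glue `wallShape_of_kinematicShadowAncient` depends on the OPEN shadow
`KinematicShadowAncient` alone.  In the sketch: `theorem boundedCurlOfClass_holds : BoundedCurlOfClass := Theorems.PoloidalLiouville.KinematicShadow.boundedCurlOfClass`.

HONEST LABEL (KEY-NS #185): bookkeeping for a crux idea graded PASS-WITH-PRICE (V20); the shadow `KinematicShadowAncient/Steady`, the rungs A/A′/C,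
`PoloidalLiouville` (1222), W1 and the summit stay OPEN; NO Navier–Stokes regularity statement is proved.
`--supports stmt-NavierStokesRegularity-1222 --as helper`.  [folklore]
-/

noncomputable section

-- the summit and its single sub-problem share the name (CONVENTIONS §1)
set_option linter.dupNamespace false

open Set Function MeasureTheory

namespace Summit.NavierStokesRegularity.NavierStokesRegularity.Theorems.PoloidalLiouville.KinematicShadow

/-- **`BoundedCurlOfClass` (kinematic-shadow sketch, the bridge binder), by name**: bounded ancient mild solutions, measurable and jointly
smooth on the past slab, have bounded vorticity — the second conjunct of the landed `vorticityOfClass` (p629171).  No NS regularity statement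
is proved. [cite: KochNadirashviliSereginSverak2009, §4 p. 8 (bounded mild ancient solutions are smooth with bounded derivatives)] -/
theorem boundedCurlOfClass :
    ∀ (v : ℝ → EuclideanSpace ℝ (Fin 3) → EuclideanSpace ℝ (Fin 3)),
    Literature.Analysis.FluidPDE.IsBoundedAncientMildSolution 1 v →
    (∀ t < 0, AEStronglyMeasurable (v t) volume) →
    ContDiffOn ℝ (⊤ : ℕ∞) (Function.uncurry v) (Set.Iio 0 ×ˢ Set.univ) →
    ∃ K : ℝ, ∀ t < 0, ∀ x, ‖Literature.Analysis.FluidPDE.curl (v t) x‖ ≤ K :=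
  fun v hB hm hsm => (vorticityOfClass v hB hm hsm).2

end Summit.NavierStokesRegularity.NavierStokesRegularity.Theorems.PoloidalLiouville.KinematicShadow

end
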